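import Literature.MathematicalPhysics.QuantumFieldTheory.Balaban1983to89.T4TermwiseUN
import Literature.MathematicalPhysics.QuantumFieldTheory.Balaban1983to89.T4TermwiseChainSU2

/-!
# T4TermwiseChainUN — the term-wise (U)(L) producers for G = U(N) Wilson terms, EVERY N, PLUGGED INTO the good-class ledger

HONEST FRAMING (T4-DAG page 1, repeated on purpose). This file is bookkeeping on a FIXED FINITE four-torus at rung
(B)+1 of the cell's ladder: it concerns existence/uniqueness of the `ε → 0` limit of unit-scale block-averaged
expectations in finite volume, CONDITIONALLY. It is NOT infinite volume, NOT a mass gap, NOT the Clay statement, and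
NOT a proof of the spine estimate NE7 (matching of the two runs' constants with `Σ_K δ_K < ∞`). NE7 is NOT PRINTED in
[Balaban1983]–[Balaban1989LargeFieldII] (one run at fixed `ε`, bounds uniform in `ε`; no two-run comparison) and is NOT
proved here. No sentence of print is quoted in this file; nothing printed is asserted. ABSOLUTE RULE honoured: every
hypothesis below is a NAMED binder of the theorem; none is minted as a fact, none is hidden in a definition.

## What this leaf does (generation 13 of lineage t4-ne7-p1, second leaf; technique: TERM-WISE matching)
Generation 9's `T4TermwiseClassical.goodClause_summable_of_kindsRA_lift` delivers the GOOD-CLASS half of the hybrid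
matching with an explicit `δ⁗_K` and `Summable δ⁗` from the ledger kinds, taking the one-step classical errors (U)
`hUdev hdU0 hdU` and (L) `hLdev hdL0 hdL` as hypotheses; generation 10 (`T4TermwiseQuartic.interpolation_averaging_
of_regular`) re-expressed those six binders through the REGULARITY of one step ((wt)(ker)(cnt)(repr)(tr)(bch)(sz)(osc)
(scal)) over an abstract real inner-product space `V` with a weight `e` squeezed between `|v|²/2 − q₄|v|⁴` and `|v|²/2`.
Generation 12 instantiated it for `SU(2)` (`V = ℍ`, `q₄ = 1/24`; `T4TermwiseInstantiate`, `T4TermwiseOscillation`,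
`T4TermwiseChainSU2`).  The first leaf of generation 13, `T4TermwiseUN`, supplied the (id-V)+(wt) binders for
`G ⊂ U(N)`, EVERY `N ≥ 1`: `V = u(N)` (`uN`, the skew-Hermitian matrices with the normalised Hilbert–Schmidt scalar
product of (17)), the orthogonal projection `π = piU` (`1`-Lipschitz for the operator norm, (20)), the weight
`eN v = 1 − N⁻¹ Re tr exp v` with the two-sided bound `eN_sandwich` (`q₄ = N/24`), the `u(N)`-valued packaging
`phiU`/`psiU`/`PhiU` of Bałaban's plaquette variables, their block averages ((14)–(15) of [Balaban1985Averaging], axial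
gauge (9)/p. 24, transcribed in `B7Prop1Explicit`/`B7Prop2Explicit`; NOT quoted here) and the transported data, and
the one-level inequalities (tr) `norm_PhiU`, (bch) `bch_PhiU`, (sz) `norm_phiU_psiU_le`, (repr-plaquette)
`wilson_phiU_psiU`.

THIS FILE composes them, for `U(N)` and every `N`, exactly as generation 12 did for `SU(2)`:
* §1 the explicit geometric majorants `dUN N …`, `dLN N …` (generation 12's `dU4`/`dL4` with the quartic coefficient
  `1/24` replaced by `N/24`; `dUN 1 = dU4`, `dLN 1 = dL4`);
* §2 the one-level binders (bch)/(sz) at `d = 4` in the normal form `20480·L²·α₀ ≤ 1` (generation 12's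
  `smallness_four`/`bchBound_four`, which do not depend on the group);
* §3 generation 10's (osc-U) inequality at one level for `U(N)` (`norm_PhiU_sub_PhiU`: two fine labels in the support
  of the averaging kernel carry transported data at most `4dL·α₁` apart in `u(N)`), from the one-letter covariant
  oscillation bound by telescoping along the two tree contours of the window (generation 12's generic
  `T4TermwiseOscillation.hol_conj_osc`) and the `1`-Lipschitz projection — NO smallness needed;
* §4 the capstone `interpolation_averaging_UN`: ONE CALL of generation 10's theorem with `V = u(N)`, `e = eN`,
  `q₄ = N/24`, `vol = M⁴`, `n₀ = #planes`, `c₁ = cSZ`, `c₂ = cOSC`, `c₃ = cBCH`, in which (wt)(ker)(cnt)(tr)(bch)(sz)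
  (osc-U)(scal) are DISCHARGED by the lineage's theorems and the remaining hypotheses are, BY NAME: the smallness `hαK`
  (`20480·L²·α₀(K) ≤ 1`), the per-scale BACKGROUND AXIOMS `hA hB` ((44): `U(N)`-valued, `M·L^{K+1}`-periodic bond
  variables with `‖V(∂p) − 1‖ ≤ α₀(K)` — the small-field condition, an INPUT) and `hAosc` ((44∇): forward-bond
  covariant nearest-neighbour oscillation of the plaquette logarithm `≤ α₁(K)`, run A — an INPUT, NOT PRINTED as
  used), the DECAY LAWS `hdecay` (`α₀(K) ≤ c_α ε₁ L^{−2K}`, (B)-type INPUT) and `hα₁K` (`0 ≤ α₁(K) ≤ c_{α1} ε₁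
  L^{−2(K+1)} L^{−K}`, (B∇)-type INPUT), `hcα hε₁`, (repr) `hreprU hreprL` (the weight-free actions ARE the `U(N)`
  Wilson plaquette sums `Σ eN (φ_U)`, `Σ eN (ψ_U)` of the named configurations — definitional in print for the Wilson
  action `Σ_p (1 − N⁻¹ Re tr V(∂p))` by `T4TermwiseUN.wilson_phiU_psiU`, a hypothesis because `f₁ g Q` are abstract),
  `2 ≤ M`, `2 ≤ L`, genuine planes;
* §5 the one remaining `exact`: `goodClause_summable_UN` = generation 9's theorem with (U)(L) SUPPLIED by §4.  Its
  other hypotheses are the LEDGER KINDS of generation 9, unchanged, all hypotheses, none discharged here: composed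
  E-rate `hUR` (a HYPOTHESIS; in the cell's DAG the composed rate is the business of the upstream nodes NE2–NE5, whose
  own conditionals — BetaPertH, (B), (B^μ) — are theirs and are neither discharged nor restated here), boundary family
  `hURB`, 𝐑-family `hURR`, format (F) `hfmtA hfmtB hint hoff`, (S) `hS hSle`, multiplicities (M)(M-B)(M-R) `hM hMB
  hMR`, witness (F′) `hwit`, (B-adm)(B-win) `hpend hBwin`, (N) `hnpos hzA hzB hzAs hzBs`, (Q) `hq`, (R-sc)(R-S) `hrsc
  hRSA hRSB`, the flow window (0.31) of BOTH coupling tables `h031A h031B` (in the discrete form `Step.Discrete031`,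
  exactly as in generations 8–12; an INPUT), (min-A)(Q)(lift)(min-B)(act) `hminA hQ hlift hminB hact hw₀`, (γ) `hγ
  hrγ`, (R-w) `hwpos hRw hRRw hrw`, (W-w) `hWw hsw`; and the comparison `hMvol : (M : ℝ)⁴ ≤ vol`.
  OUTPUT: `GoodClause l₀ vol T A B Bad δ⁗ ∧ Summable δ⁗` with generation 9's `δ⁗` in which the action-kind share is
  `w₀·(dUN N L #planes c_α c_{α1} ε₁ K + dLN N L #planes c_α ε₁ K)`, `N = Fintype.card n`; summable by the geometric
  factor `(L⁻²)^K` (`2 ≤ L`).  Nothing else changes; no ledger kind is weakened or strengthened;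
* §6 toys: the constant configuration `V ≡ 1 ∈ U(3)` satisfies the configuration hypotheses with `α₀ = α₁ = 0`
  (non-vacuity of `hA`/`hB`/`hAosc`), and the majorants vanish at `ε₁ = 0`.

The index type `n` of the matrices is any nonempty finite type (`N = Fintype.card n ≥ 1`); `G` is any subgroup of
`U(N)` in the sense that only `V(b) ∈ unitaryUnits` is used — in particular `SU(N)` configurations qualify through
`B7Prop2SpecialUnitary.specialUnitaryUnits_le_unitaryUnits`, at the constant cost `q₄ = N/24` instead of the optimal
group-dependent constant (for `SU(2)` generation 12's quaternion model gives `1/24`; the present file gives `2/24`).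

## What is NOT delivered
Any discharge of a ledger kind; any derivation of (44)/(44∇) or of their decay laws from print (they are the shape of
the series' inductive small-field hypotheses — whether a DERIVATIVE bound of strength `ε₁L^{−3K−2}` is among them is
the literature seats' question, not asserted); (repr) for non-Wilson terms; the bad-class half (node U5b/c, other
lineages); infinite volume; anything at rung (B)+2 or above.

## Register
Everything here is [folklore] plumbing (normal forms, one telescoping estimate transported by a `1`-Lipschitz map, one
call, one `exact`, two abbreviating definitions). Loci named for orientation only: [Balaban1985Averaging] (the
averaging operation (14)–(15), the axial gauge (9)/p. 24, the norms (17)/(20), via `B7Prop1Explicit`, `MatrixNorms`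
and `T4TermwiseUN`), [Balaban1987RG1] ((0.31), as located by generations 8–10 upstream, via `Step.Discrete031`).
No quotation.
-/

noncomputable section

open Finset MeasureTheory _root_.Filter _root_.Topology
open scoped BigOperators Matrix.Norms.L2Operator InnerProductSpace

namespace Literature.MathematicalPhysics.QuantumFieldTheory.Balaban1983to89.T4TermwiseChainUN

open T4OutputRate T4RecentScale T4GoodClassBudget T4CauchySum T4Crossover T4TowerRateComposition T4TowerRateDischarge
open T4BoundaryCarrier (BFunctional atFl NE9Fl LipBackgroundFl NE5B)
open T4TermwiseBudget T4TermwiseDeviation T4TermwiseCurrency T4TermwiseBoundary T4TermwiseResidual T4TermwiseAction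
open T4TermwiseClassical T4TermwiseQuartic
open T4TermwiseInstantiate (cBCH cBCH_nonneg smallness_four bchBound_four rho_le_of_decay cSZ cSZ_nonneg
  half_of_smallness size_le_of_decay)
open T4TermwiseOscillation (norm_conj_sub_conj hol_conj_osc step_osc_of_bond_osc farCorner l1_zpos_sub_farCorner_le cOSC)
open B7Prop1Explicit B7Prop2Explicit T4TermwiseBCH T4TermwiseTorus T4TermwiseUN

/-! ## §1 The explicit geometric majorants of (U) and (L) for `U(N)` Wilson terms (`q₄ = N/24`) -/

/-- The (U)-majorant per unit block for `U(N)` Wilson terms: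
`dUN N L n c_α c_{α1} ε₁ K = n·(cOSC² ε₁²/4 + cSZ·cBCH·ε₁³ + (N/24)(cSZ ε₁ + cBCH ε₁²)⁴)·(L⁻²)^K`
(`n` = number of plaquette planes carried; `cOSC = 16L c_{α1}`, `cSZ = 2L²c_α`, `cBCH = 280(320L²c_α)²` — the
constants of the `SU(2)` leaves, which do not depend on the group). [folklore] -/
def dUN (N L n : ℕ) (cα cα₁ ε₁ : ℝ) (K : ℕ) : ℝ :=
  (n : ℝ) * (cOSC L cα₁ ^ 2 * ε₁ ^ 2 / 4 + cSZ L cα * cBCH L cα * ε₁ ^ 3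
    + (N : ℝ) / 24 * (cSZ L cα * ε₁ + cBCH L cα * ε₁ ^ 2) ^ 4) * (((L : ℝ) ^ 2)⁻¹) ^ K

/-- The (L)-majorant per unit block for `U(N)` Wilson terms:
`dLN N L n c_α ε₁ K = n·(cSZ·cBCH·ε₁³ + cBCH² ε₁⁴/2 + (N/24) cSZ⁴ ε₁⁴)·(L⁻²)^K`. [folklore] -/
def dLN (N L n : ℕ) (cα ε₁ : ℝ) (K : ℕ) : ℝ :=
  (n : ℝ) * (cSZ L cα * cBCH L cα * ε₁ ^ 3 + cBCH L cα ^ 2 * ε₁ ^ 4 / 2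
    + (N : ℝ) / 24 * (cSZ L cα ^ 4 * ε₁ ^ 4)) * (((L : ℝ) ^ 2)⁻¹) ^ K

/-- Unfolding lemma for `dUN`. [folklore] -/
theorem dUN_def (N L n : ℕ) (cα cα₁ ε₁ : ℝ) (K : ℕ) :
    dUN N L n cα cα₁ ε₁ K = (n : ℝ) * (cOSC L cα₁ ^ 2 * ε₁ ^ 2 / 4 + cSZ L cα * cBCH L cα * ε₁ ^ 3
      + (N : ℝ) / 24 * (cSZ L cα * ε₁ + cBCH L cα * ε₁ ^ 2) ^ 4) * (((L : ℝ) ^ 2)⁻¹) ^ K := rfl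

/-- Unfolding lemma for `dLN`. [folklore] -/
theorem dLN_def (N L n : ℕ) (cα ε₁ : ℝ) (K : ℕ) :
    dLN N L n cα ε₁ K = (n : ℝ) * (cSZ L cα * cBCH L cα * ε₁ ^ 3 + cBCH L cα ^ 2 * ε₁ ^ 4 / 2
      + (N : ℝ) / 24 * (cSZ L cα ^ 4 * ε₁ ^ 4)) * (((L : ℝ) ^ 2)⁻¹) ^ K := rfl

/-- At `N = 1` the majorants are those of the `SU(2)` leaves (`T4TermwiseChainSU2.dU4` / `dL4`, `q₄ = 1/24`): the
constants agree, only the quartic coefficient scales with `N`. [folklore] -/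
theorem dUN_one_dLN_one (L n : ℕ) (cα cα₁ ε₁ : ℝ) (K : ℕ) :
    dUN 1 L n cα cα₁ ε₁ K = T4TermwiseChainSU2.dU4 L n cα cα₁ ε₁ K ∧
      dLN 1 L n cα ε₁ K = T4TermwiseChainSU2.dL4 L n cα ε₁ K := by
  simp [dUN, dLN, T4TermwiseChainSU2.dU4, T4TermwiseChainSU2.dL4]

/-! ## §2 The one-level binders for `U(N)` at `d = 4` in normal form -/

section Four

variable {n : Type*} [Fintype n] [DecidableEq n]

/-- (bch) at one level, `d = 4`, normal form: for a `U(N)`-valued configuration under (44) with `20480·L²·α₀ ≤ 1` on a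
torus of side `T ≥ 2L`, `‖ψ_U(y) − Σ_{x ∈ pbox planes T} pker T L y x • Φ_U(y, x)‖ ≤ 280·(320·L²·α₀)²` in `u(N)`
(`T4TermwiseUN.bch_PhiU`). [folklore] -/
theorem bch_PhiU_four [Nonempty n] (T L : ℕ) (planes : Finset (Fin 4 × Fin 4)) (hplanes : ∀ P ∈ planes, P.1 ≠ P.2)
    {V : B7Prop1Explicit.Site 4 → Fin 4 → (Matrix n n ℂ)ˣ} (hV : ∀ x κ, V x κ ∈ unitaryUnits (Matrix n n ℂ))
    (hL : 1 ≤ L) (h2L : 2 * L ≤ T) {α₀ : ℝ} (hα₀ : 0 ≤ α₀) (hsmall : 20480 * (L : ℝ) ^ 2 * α₀ ≤ 1)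
    (h44 : ∀ (x : B7Prop1Explicit.Site 4) (κ κ' : Fin 4), κ ≠ κ' →
      ‖((hol V x (plaqWord κ κ') : (Matrix n n ℂ)ˣ) : Matrix n n ℂ) - 1‖ ≤ α₀)
    (y : (Fin 4 × Fin 4) × B7Prop1Explicit.Site 4) (hy : y.1 ∈ planes) :
    ‖psiU L V y - ∑ x ∈ pbox planes T, pker T L y x • PhiU T L V y x‖ ≤ 280 * (320 * (L : ℝ) ^ 2 * α₀) ^ 2 := by
  have h := bch_PhiU T L planes hplanes hV hL h2L hα₀ (smallness_four hsmall) h44 y hy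
  rwa [bchBound_four] at h

/-- (sz) at one plaquette, `d = 4`, normal form: for a `U(N)`-valued configuration under (44) with `20480·L²·α₀ ≤ 1` and
a genuine plane, `‖φ_U(x)‖ ≤ 2α₀` (`T4TermwiseUN.norm_phiU_psiU_le`; (20) and (26)). [folklore] -/
theorem norm_phiU_le_four [Nonempty n] {L : ℕ} (hL : 1 ≤ L) {V : B7Prop1Explicit.Site 4 → Fin 4 → (Matrix n n ℂ)ˣ}
    (hV : ∀ x κ, V x κ ∈ unitaryUnits (Matrix n n ℂ)) {α₀ : ℝ} (hα₀ : 0 ≤ α₀)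
    (hsmall : 20480 * (L : ℝ) ^ 2 * α₀ ≤ 1)
    (h44 : ∀ (x : B7Prop1Explicit.Site 4) (κ κ' : Fin 4), κ ≠ κ' →
      ‖((hol V x (plaqWord κ κ') : (Matrix n n ℂ)ˣ) : Matrix n n ℂ) - 1‖ ≤ α₀)
    (x : (Fin 4 × Fin 4) × B7Prop1Explicit.Site 4) (hx : x.1.1 ≠ x.1.2) : ‖phiU V x‖ ≤ 2 * α₀ :=
  (norm_phiU_psiU_le L hV hL hα₀ (smallness_four hsmall) h44 x x hx hx).1

end Four

/-! ## §3 The window oscillation of the transported datum for `U(N)`: generation 10's (osc-U) inequality at one level -/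

section Osc

variable {n : Type*} [Fintype n] [DecidableEq n] {d : ℕ}

/-- `T4TermwiseUN.GM` as a conjugate: `GM(y, x′) = u(La)⁻¹ · (u(x′) log V(∂p_{x′}) u(x′)⁻¹) · u(La)`, `u = axialFn V c`,
`c` the far corner (`T4TermwiseOscillation.farCorner`). [folklore] -/
theorem GM_eq_conj_U (L : ℕ) (V : B7Prop1Explicit.Site d → Fin d → (Matrix n n ℂ)ˣ)
    (y : (Fin d × Fin d) × B7Prop1Explicit.Site d) (x' : B7Prop1Explicit.Site d) :
    GM L V y x' = (((axialFn V (farCorner L y) ((L : ℤ) • y.2))⁻¹ : (Matrix n n ℂ)ˣ) : Matrix n n ℂ)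
      * (((axialFn V (farCorner L y) x' : (Matrix n n ℂ)ˣ) : Matrix n n ℂ) * phiM V y.1 x'
          * (((axialFn V (farCorner L y) x')⁻¹ : (Matrix n n ℂ)ˣ) : Matrix n n ℂ))
      * ((((axialFn V (farCorner L y) ((L : ℤ) • y.2))⁻¹)⁻¹ : (Matrix n n ℂ)ˣ) : Matrix n n ℂ) := by
  simp only [GM, farCorner, mul_inv_rev, inv_inv, Units.val_mul, mul_assoc]

/-- **WINDOW OSCILLATION OF THE TRANSPORTED DATUM, `U(N)`.** Under the one-letter covariant oscillation bound `α₁` for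
the plaquette-log field of the plane of `y`, `|GM(y, p) − GM(y, p′)| ≤ (|p − c|₁ + |p′ − c|₁)·α₁` in the operator norm,
`c` the far corner (`T4TermwiseOscillation.hol_conj_osc` along the two tree contours from `c`, B7 p. 24, and the
isometry of conjugation by the unitary `u(La)⁻¹`). [folklore] -/
theorem norm_GM_sub_GM_U [Nonempty n] (L : ℕ) {V : B7Prop1Explicit.Site d → Fin d → (Matrix n n ℂ)ˣ}
    (hV : ∀ x κ, V x κ ∈ unitaryUnits (Matrix n n ℂ))
    (y : (Fin d × Fin d) × B7Prop1Explicit.Site d) {α₁ : ℝ}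
    (hstep : ∀ (x : B7Prop1Explicit.Site d) (l : Letter d),
      ‖((stepHol V x l : (Matrix n n ℂ)ˣ) : Matrix n n ℂ) * phiM V y.1 (x + l.vec)
          * (((stepHol V x l)⁻¹ : (Matrix n n ℂ)ˣ) : Matrix n n ℂ) - phiM V y.1 x‖ ≤ α₁)
    (p p' : B7Prop1Explicit.Site d) :
    ‖GM L V y p - GM L V y p'‖ ≤ ((l1 (p - farCorner L y) : ℝ) + l1 (p' - farCorner L y)) * α₁ := by
  have hU : ∀ x κ, V x κ ∈ U1 (Matrix n n ℂ) := U1_of_U hV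
  have hW : ∀ q : B7Prop1Explicit.Site d,
      ‖((axialFn V (farCorner L y) q : (Matrix n n ℂ)ˣ) : Matrix n n ℂ) * phiM V y.1 q
          * (((axialFn V (farCorner L y) q)⁻¹ : (Matrix n n ℂ)ˣ) : Matrix n n ℂ)
        - phiM V y.1 (farCorner L y)‖ ≤ (l1 (q - farCorner L y) : ℝ) * α₁ := fun q => by
    have h := hol_conj_osc hU (phiM V y.1) hstep (treeWord (q - farCorner L y)) (farCorner L y)
    rw [disp_treeWord, show farCorner L y + (q - farCorner L y) = q by abel, length_treeWord] at h
    exact h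
  rw [GM_eq_conj_U, GM_eq_conj_U, norm_conj_sub_conj ((U1 (Matrix n n ℂ)).inv_mem (axialFn_mem hU _ _))]
  calc _ = ‖(((axialFn V (farCorner L y) p : (Matrix n n ℂ)ˣ) : Matrix n n ℂ) * phiM V y.1 p
              * (((axialFn V (farCorner L y) p)⁻¹ : (Matrix n n ℂ)ˣ) : Matrix n n ℂ) - phiM V y.1 (farCorner L y))
          + (phiM V y.1 (farCorner L y) - ((axialFn V (farCorner L y) p' : (Matrix n n ℂ)ˣ) : Matrix n n ℂ)
              * phiM V y.1 p' * (((axialFn V (farCorner L y) p')⁻¹ : (Matrix n n ℂ)ˣ) : Matrix n n ℂ))‖ := by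
          rw [sub_add_sub_cancel]
    _ ≤ _ := norm_add_le _ _
    _ ≤ (l1 (p - farCorner L y) : ℝ) * α₁ + (l1 (p' - farCorner L y) : ℝ) * α₁ :=
        add_le_add (hW p) (by rw [norm_sub_rev]; exact hW p')
    _ = _ := by ring

/-- **GENERATION 10's (osc-U) INEQUALITY AT ONE LEVEL, `U(N)`, in `V = u(N)`.** For a `U(N)`-valued configuration whose
plaquette-log field in the plane of `y` has one-letter covariant oscillation `≤ α₁` (operator norm), two fine labels in
the support of the averaging kernel of `y` carry transported data at most `4dL·α₁` apart in `u(N)`: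
`0 < pker y x → 0 < pker y x′ → ‖Φ_U(y, x) − Φ_U(y, x′)‖ ≤ 4dL·α₁` (`π` is `1`-Lipschitz, (20)).  No smallness is
needed. [folklore] -/
theorem norm_PhiU_sub_PhiU [Nonempty n] (T L : ℕ) {V : B7Prop1Explicit.Site d → Fin d → (Matrix n n ℂ)ˣ}
    (hV : ∀ x κ, V x κ ∈ unitaryUnits (Matrix n n ℂ)) {α₁ : ℝ} (hα₁ : 0 ≤ α₁)
    (y x x' : (Fin d × Fin d) × B7Prop1Explicit.Site d) (hy : y.1.1 ≠ y.1.2)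
    (hstep : ∀ (z : B7Prop1Explicit.Site d) (l : Letter d),
      ‖((stepHol V z l : (Matrix n n ℂ)ˣ) : Matrix n n ℂ) * phiM V y.1 (z + l.vec)
          * (((stepHol V z l)⁻¹ : (Matrix n n ℂ)ˣ) : Matrix n n ℂ) - phiM V y.1 z‖ ≤ α₁)
    (hx : 0 < pker T L y x) (hx' : 0 < pker T L y x') :
    ‖PhiU T L V y x - PhiU T L V y x'‖ ≤ 4 * (d : ℝ) * L * α₁ := by
  have key : ∀ {x : (Fin d × Fin d) × B7Prop1Explicit.Site d}, 0 < pker T L y x →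
      ∃ s ∈ slots L, PhiU T L V y x = piU (GM L V y (zpos L y.1.1 y.1.2 ((L : ℤ) • y.2) s)) := by
    intro x hx
    unfold pker at hx
    split_ifs at hx with h
    · obtain ⟨s, hs, -, hG⟩ := textend_of_tker_ne_zero T L y.1.1 y.1.2 (GM L V y) (phiM V y.1) hx.ne'
      refine ⟨s, hs, ?_⟩
      rw [PhiU, if_pos h.symm, hG]
    · exact absurd hx (lt_irrefl 0)
  obtain ⟨s, hs, hPx⟩ := key hx
  obtain ⟨s', hs', hPx'⟩ := key hx'
  rw [hPx, hPx']
  calc _ ≤ ‖GM L V y (zpos L y.1.1 y.1.2 ((L : ℤ) • y.2) s) - GM L V y (zpos L y.1.1 y.1.2 ((L : ℤ) • y.2) s')‖ :=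
        norm_piU_sub_le _ _
    _ ≤ ((l1 (zpos L y.1.1 y.1.2 ((L : ℤ) • y.2) s - farCorner L y) : ℝ)
          + l1 (zpos L y.1.1 y.1.2 ((L : ℤ) • y.2) s' - farCorner L y)) * α₁ := norm_GM_sub_GM_U L hV y hstep _ _
    _ ≤ (2 * d * L + 2 * d * L) * α₁ := by
        gcongr
        exacts [l1_zpos_sub_farCorner_le hy y.2 hs, l1_zpos_sub_farCorner_le hy y.2 hs']
    _ = 4 * (d : ℝ) * L * α₁ := by ring

end Osc

/-! ## §4 The capstone for `U(N)`: generation 10's theorem CALLED, every term-wise binder DISCHARGED -/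

section Capstone

variable {n : Type*} [Fintype n] [DecidableEq n] [Nonempty n]
variable {ι : Type} {σ : Type*} [DecidableEq σ] {l₀ : ℝ} {T : ℕ → Finset σ} {Bad : ℕ → ℝ → Finset σ} {Adm : Set ι}

/-- **(U)(L) FOR `U(N)` WILSON TERMS, EVERY `N`, FROM THE LINEAGE's THEOREMS — ONE CALL of
`T4TermwiseQuartic.interpolation_averaging_of_regular` with `V = u(N)` (`T4TermwiseUN.uN`), `e = eN`,
`q₄ = N/24`, `Xf = Xc = (Fin 4 × Fin 4) × ℤ⁴`, `Pf K = pbox planes (M·L^K·L)`, `Pc K = pbox planes (M·L^K)`,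
`w K = pker (M·L^K·L) L`, `n₀ = #planes`, `vol = M⁴`, `φA = phiU`, `ψA = psiU L`, `ΦA = PhiU (M·L^K·L) L` (same for run B),
`s_K = 2α₀(K)`, `ω_K = 16L·α₁(K)`, `ρb_K = 280(320L²α₀(K))²`, `c₁ = cSZ`, `c₂ = cOSC`, `c₃ = cBCH`.**  Its binders (wt)
`he hq₄` (`eN_sandwich`), (ker)(cnt) (`kernel_tower_geometric`), (tr) `hΦA hΦB` (`norm_PhiU`, no smallness), (bch)
`hρA hρB` (`bch_PhiU_four`), (sz) `hsA hsB hs hc₁` (`norm_phiU_le_four`, `size_le_of_decay`), (osc-U) `hoscA hω`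
(`norm_PhiU_sub_PhiU` from the (44∇) hypothesis `hAosc` and its law `hα₁K`), (scal) `hρb hc₃` (`rho_le_of_decay`) are
DISCHARGED.  REMAINING hypotheses, BY NAME: `hαK` (smallness), `hA`/`hB` (the two runs' backgrounds are `U(N)`-valued,
`M·L^{K+1}`-periodic and satisfy (44) with `α₀(K)`), `hAosc` ((44∇) for run A), `hcα`, `hdecay` ((B)-type INPUT
`α₀(K) ≤ c_α ε₁ L^{−2K}`), `hα₁K` ((B∇)-type INPUT), (repr) `hreprU`/`hreprL` (the good term's `f₁`, `g` ARE the
Wilson sums `Σ eN (φ_U)`, `Σ eN (ψ_U)`), `hε₁`, `2 ≤ M`, `2 ≤ L`, genuine planes.  None of the remaining analytic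
laws is printed as used; NE7 remains NOT PRINTED and NOT PROVED. [folklore] -/
theorem interpolation_averaging_UN {Y YA : Type*} {g : ℕ → ℝ → σ → ι → YA → ℝ}
    {f₁ : ℕ → ℝ → σ → ι → Y → ℝ} {Q : ℕ → ℝ → σ → ι → Y → YA} {yA yB : ℕ → ℝ → σ → ι → Y}
    {xA : ℕ → ℝ → σ → ι → YA}
    (M L : ℕ) (hM : 2 ≤ M) (hL : 2 ≤ L) (planes : Finset (Fin 4 × Fin 4)) (hplanes : ∀ P ∈ planes, P.1 ≠ P.2)
    (VA VB : ℕ → ℝ → σ → ι → (B7Prop1Explicit.Site 4 → Fin 4 → (Matrix n n ℂ)ˣ))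
    {αK α₁K : ℕ → ℝ} {cα cα₁ ε₁ : ℝ}
    (hαK : ∀ K, 0 ≤ αK K ∧ 20480 * (L : ℝ) ^ 2 * αK K ≤ 1)
    (hA : ∀ K t, |t| ≤ l₀ → ∀ τ ∈ T K \ Bad K t, ∀ v ∈ Adm,
      (∀ x κ, VA K t τ v x κ ∈ unitaryUnits (Matrix n n ℂ)) ∧ IsPeriodic (M * L ^ K * L) (VA K t τ v) ∧
        ∀ (x : B7Prop1Explicit.Site 4) (κ κ' : Fin 4), κ ≠ κ' →
          ‖((hol (VA K t τ v) x (plaqWord κ κ') : (Matrix n n ℂ)ˣ) : Matrix n n ℂ) - 1‖ ≤ αK K)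
    (hB : ∀ K t, |t| ≤ l₀ → ∀ τ ∈ T K \ Bad K t, ∀ v ∈ Adm,
      (∀ x κ, VB K t τ v x κ ∈ unitaryUnits (Matrix n n ℂ)) ∧ IsPeriodic (M * L ^ K * L) (VB K t τ v) ∧
        ∀ (x : B7Prop1Explicit.Site 4) (κ κ' : Fin 4), κ ≠ κ' →
          ‖((hol (VB K t τ v) x (plaqWord κ κ') : (Matrix n n ℂ)ˣ) : Matrix n n ℂ) - 1‖ ≤ αK K)
    (hAosc : ∀ K t, |t| ≤ l₀ → ∀ τ ∈ T K \ Bad K t, ∀ v ∈ Adm, ∀ P ∈ planes,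
      ∀ (z : B7Prop1Explicit.Site 4) (κ : Fin 4),
        ‖((VA K t τ v z κ : (Matrix n n ℂ)ˣ) : Matrix n n ℂ) * phiM (VA K t τ v) P (z + e κ)
            * (((VA K t τ v z κ)⁻¹ : (Matrix n n ℂ)ˣ) : Matrix n n ℂ) - phiM (VA K t τ v) P z‖ ≤ α₁K K)
    (hcα : 0 ≤ cα) (hdecay : ∀ K, αK K ≤ cα * ε₁ * (((L : ℝ) ^ K)⁻¹) ^ 2)
    (hα₁K : ∀ K, 0 ≤ α₁K K ∧ α₁K K ≤ cα₁ * ε₁ * (((L : ℝ) ^ (K + 1))⁻¹) ^ 2 * ((L : ℝ) ^ K)⁻¹)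
    (hreprU : ∀ K t, |t| ≤ l₀ → ∀ τ ∈ T K \ Bad K t, ∀ v ∈ Adm,
      f₁ K t τ v (yA K t τ v) = ∑ x ∈ pbox planes (M * L ^ K * L), eN (phiU (VA K t τ v) x) ∧
        g K t τ v (xA K t τ v) = ∑ y ∈ pbox planes (M * L ^ K), eN (psiU L (VA K t τ v) y))
    (hreprL : ∀ K t, |t| ≤ l₀ → ∀ τ ∈ T K \ Bad K t, ∀ v ∈ Adm,
      f₁ K t τ v (yB K t τ v) = ∑ x ∈ pbox planes (M * L ^ K * L), eN (phiU (VB K t τ v) x) ∧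
        g K t τ v (Q K t τ v (yB K t τ v)) = ∑ y ∈ pbox planes (M * L ^ K), eN (psiU L (VB K t τ v) y))
    (hε₁ : 0 ≤ ε₁) :
    (∀ K t, |t| ≤ l₀ → ∀ τ ∈ T K \ Bad K t, ∀ v ∈ Adm,
      f₁ K t τ v (yA K t τ v) - g K t τ v (xA K t τ v)
        ≤ (M : ℝ) ^ 4 * ((planes.card : ℝ) * (cOSC L cα₁ ^ 2 * ε₁ ^ 2 / 4 + cSZ L cα * cBCH L cα * ε₁ ^ 3
            + (Fintype.card n : ℝ) / 24 * (cSZ L cα * ε₁ + cBCH L cα * ε₁ ^ 2) ^ 4) * (((L : ℝ) ^ 2)⁻¹) ^ K)) ∧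
    (∀ K t, |t| ≤ l₀ → ∀ τ ∈ T K \ Bad K t, ∀ v ∈ Adm,
      g K t τ v (Q K t τ v (yB K t τ v)) - f₁ K t τ v (yB K t τ v)
        ≤ (M : ℝ) ^ 4 * ((planes.card : ℝ) * (cSZ L cα * cBCH L cα * ε₁ ^ 3 + cBCH L cα ^ 2 * ε₁ ^ 4 / 2
            + (Fintype.card n : ℝ) / 24 * (cSZ L cα ^ 4 * ε₁ ^ 4)) * (((L : ℝ) ^ 2)⁻¹) ^ K)) ∧
    (∀ K, 0 ≤ (planes.card : ℝ) * (cOSC L cα₁ ^ 2 * ε₁ ^ 2 / 4 + cSZ L cα * cBCH L cα * ε₁ ^ 3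
        + (Fintype.card n : ℝ) / 24 * (cSZ L cα * ε₁ + cBCH L cα * ε₁ ^ 2) ^ 4) * (((L : ℝ) ^ 2)⁻¹) ^ K) ∧
    (∀ K, 0 ≤ (planes.card : ℝ) * (cSZ L cα * cBCH L cα * ε₁ ^ 3 + cBCH L cα ^ 2 * ε₁ ^ 4 / 2
        + (Fintype.card n : ℝ) / 24 * (cSZ L cα ^ 4 * ε₁ ^ 4)) * (((L : ℝ) ^ 2)⁻¹) ^ K) ∧
    Summable (fun K => (planes.card : ℝ) * (cOSC L cα₁ ^ 2 * ε₁ ^ 2 / 4 + cSZ L cα * cBCH L cα * ε₁ ^ 3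
        + (Fintype.card n : ℝ) / 24 * (cSZ L cα * ε₁ + cBCH L cα * ε₁ ^ 2) ^ 4) * (((L : ℝ) ^ 2)⁻¹) ^ K) ∧
    Summable (fun K => (planes.card : ℝ) * (cSZ L cα * cBCH L cα * ε₁ ^ 3 + cBCH L cα ^ 2 * ε₁ ^ 4 / 2
        + (Fintype.card n : ℝ) / 24 * (cSZ L cα ^ 4 * ε₁ ^ 4)) * (((L : ℝ) ^ 2)⁻¹) ^ K) := by
  have hM0 : 0 < M := by omega
  have hL0 : 0 < L := by omega
  have hL1 : 1 ≤ L := by omega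
  have hLr : (1 : ℝ) < L := by exact_mod_cast (lt_of_lt_of_le one_lt_two hL)
  -- the torus side `M·L^K·L` is at least two blocks: `2L ≤ M·L^K·L`
  have h2L : ∀ K, 2 * L ≤ M * L ^ K * L := fun K =>
    Nat.mul_le_mul_right L (le_trans hM (Nat.le_mul_of_pos_right M (pow_pos hL0 K)))
  have hhalf : ∀ K, αK K ≤ 1 / 2 := fun K => half_of_smallness hL1 (hαK K).2
  obtain ⟨hw, hrow, hcol, hNf, hNc⟩ := kernel_tower_geometric M L hM0 hL0 planes
  have hρ := rho_le_of_decay L (fun K => (hαK K).1) hdecay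
  have hω : ∀ K, 0 ≤ 4 * ((4 : ℕ) : ℝ) * (L : ℝ) * α₁K K ∧
      4 * ((4 : ℕ) : ℝ) * (L : ℝ) * α₁K K ≤ cOSC L cα₁ * ε₁ * (((L : ℝ) ^ (K + 1))⁻¹) ^ 2 * ((L : ℝ) ^ K)⁻¹ :=
    fun K => ⟨by have h0 := (hα₁K K).1; positivity,
      calc 4 * ((4 : ℕ) : ℝ) * (L : ℝ) * α₁K K = 16 * (L : ℝ) * α₁K K := by push_cast; ring
        _ ≤ 16 * (L : ℝ) * (cα₁ * ε₁ * (((L : ℝ) ^ (K + 1))⁻¹) ^ 2 * ((L : ℝ) ^ K)⁻¹) :=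
            mul_le_mul_of_nonneg_left (hα₁K K).2 (by positivity)
        _ = cOSC L cα₁ * ε₁ * (((L : ℝ) ^ (K + 1))⁻¹) ^ 2 * ((L : ℝ) ^ K)⁻¹ := by unfold cOSC; ring⟩
  exact interpolation_averaging_of_regular (V := ↥(uN n)) (e := eN) (q₄ := (Fintype.card n : ℝ) / 24)
    (vol := (M : ℝ) ^ 4) (n₀ := (planes.card : ℝ)) (c₁ := cSZ L cα) (c₂ := cOSC L cα₁) (c₃ := cBCH L cα)
    (s := fun K => 2 * αK K) (ω := fun K => 4 * ((4 : ℕ) : ℝ) * (L : ℝ) * α₁K K)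
    (Pf := fun K => pbox planes (M * L ^ K * L)) (Pc := fun K => pbox planes (M * L ^ K))
    (w := fun K => pker (M * L ^ K * L) L)
    (φA := fun K t τ v x => phiU (VA K t τ v) x) (ψA := fun K t τ v y => psiU L (VA K t τ v) y)
    (ΦA := fun K t τ v y x => PhiU (M * L ^ K * L) L (VA K t τ v) y x)
    (φB := fun K t τ v x => phiU (VB K t τ v) x) (ψB := fun K t τ v y => psiU L (VB K t τ v) y)
    (ΦB := fun K t τ v y x => PhiU (M * L ^ K * L) L (VB K t τ v) y x)
    (ρb := fun K => 280 * (320 * (L : ℝ) ^ 2 * αK K) ^ 2)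
    eN_sandwich (by positivity) hLr hw hrow hcol (Nat.cast_nonneg _) (by positivity)
    (fun K => (hNf K).le) (fun K => (hNc K).le) hreprU
    (fun K t ht τ hτ v hv y _ x _ => norm_PhiU _ L (hA K t ht τ hτ v hv).1 (hA K t ht τ hτ v hv).2.1 y x)
    (fun K t ht τ hτ v hv y hy =>
      bch_PhiU_four _ L planes hplanes (hA K t ht τ hτ v hv).1 hL1 (h2L K) (hαK K).1 (hαK K).2
        (hA K t ht τ hτ v hv).2.2 y (Finset.mem_product.1 hy).1)
    (fun K t ht τ hτ v hv x hx =>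
      norm_phiU_le_four hL1 (hA K t ht τ hτ v hv).1 (hαK K).1 (hαK K).2 (hA K t ht τ hτ v hv).2.2 x
        (hplanes x.1 (Finset.mem_product.1 hx).1))
    (fun K t ht τ hτ v hv y hy x _ x' _ hpos hpos' =>
      norm_PhiU_sub_PhiU (M * L ^ K * L) L (hA K t ht τ hτ v hv).1 (hα₁K K).1 y x x'
        (hplanes y.1 (Finset.mem_product.1 hy).1)
        (step_osc_of_bond_osc (U1_of_U (hA K t ht τ hτ v hv).1) (phiM (VA K t τ v) y.1)
          (hAosc K t ht τ hτ v hv y.1 (Finset.mem_product.1 hy).1)) hpos hpos')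
    hreprL
    (fun K t ht τ hτ v hv y _ x _ => norm_PhiU _ L (hB K t ht τ hτ v hv).1 (hB K t ht τ hτ v hv).2.1 y x)
    (fun K t ht τ hτ v hv y hy =>
      bch_PhiU_four _ L planes hplanes (hB K t ht τ hτ v hv).1 hL1 (h2L K) (hαK K).1 (hαK K).2
        (hB K t ht τ hτ v hv).2.2 y (Finset.mem_product.1 hy).1)
    (fun K t ht τ hτ v hv x hx =>
      norm_phiU_le_four hL1 (hB K t ht τ hτ v hv).1 (hαK K).1 (hαK K).2 (hB K t ht τ hτ v hv).2.2 x
        (hplanes x.1 (Finset.mem_product.1 hx).1))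
    (cSZ_nonneg L hcα) (cBCH_nonneg L cα) hε₁ (size_le_of_decay L hL1 (fun K => (hαK K).1) hdecay) hω hρ

end Capstone

/-! ## §5 The good-class half with `Summable δ⁗` for G = U(N) Wilson terms -/

section Ledger

variable {n : Type*} [Fintype n] [DecidableEq n] [Nonempty n]
variable {C : T4BoundaryCarrier.Carriers} {ι : Type} [MeasurableSpace ι] {σ : Type*} [DecidableEq σ] {l₀ vol : ℝ}
  {T : ℕ → Finset σ} {Bad : ℕ → ℝ → Finset σ} {A B : ℕ → ℝ → σ → ℝ} {μ : ℕ → ℝ → σ → Measure ι}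
  {fac bfac rfac : ℕ → ℝ → σ → Finset C.Dom} {Adm : Set ι} {EA : Functional C.toCarriers C.BgA}
  {EB : Functional C.toCarriers C.BgB} {BA : BFunctional C C.BgA} {BB : BFunctional C C.BgB}
  {RA : Functional C.toCarriers C.BgA} {RB : Functional C.toCarriers C.BgB}
  {κ θ' Cr EB₀ CrR R₁ b β' w₀ : ℝ} {κ₀ : ℕ} {gA gB : ℕ → ℕ → ℝ} {gfA gfB : ℕ → ℝ} {gsA gsB : ℕ → ℕ → ℝ}
  {uA : ℕ → ι → C.BgA} {uB : ℕ → ι → C.BgB} {oneA : C.BgA} {oneB : C.BgB}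
  {pend : ℕ → ℝ → σ → ι → C.Fl} {nA nB aA aB wA wB γA γB : ℕ → ℝ → σ → ι → ℝ} {qA qB : ℕ → ℝ}
  {κ₁ S : ℕ → ℝ → σ → ℕ → ℝ} {cW RW : ℕ → ℝ → σ → ℝ} {rw sw rγ zA zB c₀ : ℕ → ℝ} {Cw E a Λ Cl : ℝ}

/-- **THE GOOD-CLASS HALF WITH `Summable δ⁗` FOR G = U(N) WILSON TERMS, EVERY `N`: generation 9's
`goodClause_summable_of_kindsRA_lift` with (U) `hUdev hdU0 hdU` and (L) `hLdev hdL0 hdL` SUPPLIED by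
`interpolation_averaging_UN`.**  Every other ledger binder of generation 9 is carried BY NAME and VERBATIM (none
discharged) — in particular the flow window (0.31) of [Balaban1987RG1] sits in `h031A`/`h031B` (`Step.Discrete031`);
the `U(N)` term-wise inputs (repr) `hreprU hreprL`, the per-scale background axioms (44) `hA hB` and (44∇) `hAosc`, the
smallness `hαK`, the decay laws `hdecay` ((B)-type INPUT) and `hα₁K` ((B∇)-type INPUT), `hcα hε₁`, `2 ≤ M`, `2 ≤ L`,
genuine planes, and `hMvol : M⁴ ≤ vol` are hypotheses.  OUTPUT: the good clause with generation 9's `δ⁗` whose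
action-kind share is `w₀·(dUN N … K + dLN N … K)`, `N = Fintype.card n`, and `Summable δ⁗`.  No print is quoted; nothing
printed is asserted; NOT NE7, NOT Clay. [folklore] -/
theorem goodClause_summable_UN {Y YA : Type*} {Sfib : ℕ → ℝ → σ → ι → Set Y}
    {SfibA : ℕ → ℝ → σ → ι → Set YA} {g : ℕ → ℝ → σ → ι → YA → ℝ} {f₁ : ℕ → ℝ → σ → ι → Y → ℝ}
    {Q : ℕ → ℝ → σ → ι → Y → YA} {yA yB : ℕ → ℝ → σ → ι → Y} {xA : ℕ → ℝ → σ → ι → YA}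
    (M L : ℕ) (hMtwo : 2 ≤ M) (hLtwo : 2 ≤ L) (planes : Finset (Fin 4 × Fin 4))
    (hplanes : ∀ P ∈ planes, P.1 ≠ P.2)
    (VA VB : ℕ → ℝ → σ → ι → (B7Prop1Explicit.Site 4 → Fin 4 → (Matrix n n ℂ)ˣ))
    {αK α₁K : ℕ → ℝ} {cα cα₁ ε₁ : ℝ}
    (hUR : ∀ K, URateUpTo K EA EB (gA K) (gB K) (uA K) (uB K) Adm Cr θ' κ) (hCr : 0 ≤ Cr)
    (hθ'0 : 0 < θ') (hθ'1 : θ' < 1) (hθ'Λ : θ' ≤ Λ) (hΛ1 : 1 ≤ Λ) (hCl : 0 ≤ Cl)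
    (hURB : ∀ b ∈ C.admFl, ∀ K, URateUpTo K (atFl BA b) (atFl BB b) (gA K) (gB K) (uA K) (uB K) Adm EB₀ θ' κ)
    (hEB₀ : 0 ≤ EB₀)
    (hURR : ∀ K, URateUpTo K RA RB (gA K) (gB K) (uA K) (uB K) Adm CrR θ' κ) (hCrR : 0 ≤ CrR)
    (hfmtA : ∀ K t τ, A K t τ = ∫ v, (∏ X ∈ fac K t τ,
      Real.exp (EA (gA K) (uA K v) X - EA (gA K) oneA X)) *
        ((∏ X ∈ bfac K t τ, Real.exp (BA (gA K) (uA K v) (pend K t τ v) X)) * nA K t τ v * qA K *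
          ((∏ X ∈ rfac K t τ, Real.exp (RA (gA K) (uA K v) X - RA (gA K) oneA X)) * (Real.exp (-aA K t τ v) * wA K t τ v)))
          ∂(μ K t τ))
    (hfmtB : ∀ K t τ, B K t τ = ∫ v, (∏ X ∈ fac K t τ,
      Real.exp (EB (gB K) (uB K v) X - EB (gB K) oneB X)) *
        ((∏ X ∈ bfac K t τ, Real.exp (BB (gB K) (uB K v) (pend K t τ v) X)) * nB K t τ v * qB K *
          ((∏ X ∈ rfac K t τ, Real.exp (RB (gB K) (uB K v) X - RB (gB K) oneB X)) * (Real.exp (-aB K t τ v) * wB K t τ v)))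
          ∂(μ K t τ))
    (hint : ∀ K t, |t| ≤ l₀ → ∀ τ ∈ T K \ Bad K t,
      Integrable (fun v => (∏ X ∈ fac K t τ, Real.exp (EA (gA K) (uA K v) X - EA (gA K) oneA X)) *
        ((∏ X ∈ bfac K t τ, Real.exp (BA (gA K) (uA K v) (pend K t τ v) X)) * nA K t τ v * qA K *
          ((∏ X ∈ rfac K t τ, Real.exp (RA (gA K) (uA K v) X - RA (gA K) oneA X)) * (Real.exp (-aA K t τ v) * wA K t τ v))))
          (μ K t τ) ∧
      Integrable (fun v => (∏ X ∈ fac K t τ, Real.exp (EB (gB K) (uB K v) X - EB (gB K) oneB X)) *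
        ((∏ X ∈ bfac K t τ, Real.exp (BB (gB K) (uB K v) (pend K t τ v) X)) * nB K t τ v * qB K *
          ((∏ X ∈ rfac K t τ, Real.exp (RB (gB K) (uB K v) X - RB (gB K) oneB X)) * (Real.exp (-aB K t τ v) * wB K t τ v))))
          (μ K t τ))
    (hsc : ∀ K t, |t| ≤ l₀ → ∀ τ ∈ T K \ Bad K t, ∀ X ∈ fac K t τ, C.scale X ≤ K)
    (hoff : ∀ K t, |t| ≤ l₀ → ∀ τ ∈ T K \ Bad K t, ∀ v, v ∉ Adm →
      (∏ X ∈ fac K t τ, Real.exp (EA (gA K) (uA K v) X - EA (gA K) oneA X)) *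
        ((∏ X ∈ bfac K t τ, Real.exp (BA (gA K) (uA K v) (pend K t τ v) X)) * nA K t τ v * qA K *
          ((∏ X ∈ rfac K t τ, Real.exp (RA (gA K) (uA K v) X - RA (gA K) oneA X)) * (Real.exp (-aA K t τ v) * wA K t τ v)))
          = 0 ∧
      (∏ X ∈ fac K t τ, Real.exp (EB (gB K) (uB K v) X - EB (gB K) oneB X)) *
        ((∏ X ∈ bfac K t τ, Real.exp (BB (gB K) (uB K v) (pend K t τ v) X)) * nB K t τ v * qB K *
          ((∏ X ∈ rfac K t τ, Real.exp (RB (gB K) (uB K v) X - RB (gB K) oneB X)) * (Real.exp (-aB K t τ v) * wB K t τ v)))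
          = 0)
    (hS : ∀ K t, |t| ≤ l₀ → ∀ τ ∈ T K \ Bad K t, ∀ v ∈ Adm, ∀ j ≤ K,
      |(∑ X ∈ fac K t τ with C.scale X = j,
          (Real.log (Real.exp (EB (gB K) (uB K v) X - EB (gB K) oneB X))
            - Real.log (Real.exp (EA (gA K) (uA K v) X - EA (gA K) oneA X)))) - κ₁ K t τ j| ≤ S K t τ j)
    (hM : ∀ K t, |t| ≤ l₀ → ∀ τ ∈ T K \ Bad K t,
      Multiplicity (fac K t τ) C.scale (fun X => Real.exp (-(κ * C.d X))) Cw vol Λ K)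
    (hwit : ∀ K, ∃ v₁ ∈ Adm, uA K v₁ = oneA ∧ uB K v₁ = oneB)
    (hvol : 0 ≤ vol) (hE : 0 ≤ E) (ha0 : 0 < a) (ha1 : a < 1)
    (hSle : ∀ K t, |t| ≤ l₀ → ∀ τ ∈ T K \ Bad K t, ∀ j ≤ K, S K t τ j ≤ vol * (E * a ^ (K - j)))
    (hpend : ∀ K t, |t| ≤ l₀ → ∀ τ ∈ T K \ Bad K t, ∀ v ∈ Adm, pend K t τ v ∈ C.admFl)
    (hBwin : ∀ K t, |t| ≤ l₀ → ∀ τ ∈ T K \ Bad K t, RecentOnly (bfac K t τ) C.scale (jlogOf Cl K) K)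
    (hMB : ∀ K t, |t| ≤ l₀ → ∀ τ ∈ T K \ Bad K t,
      Multiplicity (bfac K t τ) C.scale (fun X => Real.exp (-(κ * C.d X))) Cw vol Λ K)
    (hnpos : ∀ K t, |t| ≤ l₀ → ∀ τ ∈ T K \ Bad K t, ∀ v ∈ Adm, 0 < nA K t τ v ∧ 0 < nB K t τ v)
    (hzA : ∀ K t, |t| ≤ l₀ → ∀ τ ∈ T K \ Bad K t, ∀ v ∈ Adm, |Real.log (nA K t τ v)| ≤ vol * zA K)
    (hzB : ∀ K t, |t| ≤ l₀ → ∀ τ ∈ T K \ Bad K t, ∀ v ∈ Adm, |Real.log (nB K t τ v)| ≤ vol * zB K)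
    (hzAs : Summable zA) (hzBs : Summable zB)
    (hq : ∀ K, 0 < qA K ∧ 0 < qB K)
    -- the 𝐑-kind: scales, multiplicity, one-run slice sizes, the flow window of both coupling tables
    (hrsc : ∀ K t, |t| ≤ l₀ → ∀ τ ∈ T K \ Bad K t, ∀ X ∈ rfac K t τ, C.scale X ≤ K)
    (hMR : ∀ K t, |t| ≤ l₀ → ∀ τ ∈ T K \ Bad K t,
      Multiplicity (rfac K t τ) C.scale (fun X => Real.exp (-(κ * C.d X))) Cw vol Λ K)
    (hRSA : ∀ K t, |t| ≤ l₀ → ∀ τ ∈ T K \ Bad K t, ∀ v ∈ Adm, ∀ j ≤ K,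
      |∑ X ∈ rfac K t τ with C.scale X = j, (RA (gA K) (uA K v) X - RA (gA K) oneA X)| ≤ vol * (R₁ * gsA K j ^ κ₀))
    (hRSB : ∀ K t, |t| ≤ l₀ → ∀ τ ∈ T K \ Bad K t, ∀ v ∈ Adm, ∀ j ≤ K,
      |∑ X ∈ rfac K t τ with C.scale X = j, (RB (gB K) (uB K v) X - RB (gB K) oneB X)| ≤ vol * (R₁ * gsB K j ^ κ₀))
    (hb : 0 < b) (h031A : ∀ K, Step.Discrete031 b β' K (gfA K) (gsA K))
    (h031B : ∀ K, Step.Discrete031 b β' K (gfB K) (gsB K)) (hgsA : ∀ K k, k ≤ K → 0 ≤ gsA K k)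
    (hgsB : ∀ K k, k ≤ K → 0 ≤ gsB K k) (hR₁ : 0 ≤ R₁) (hκ₀ : 4 < κ₀)
    -- the ACTION kind from ONE CLASSICAL STEP: (min-A) (Q) (lift) (min-B) (act) (U) (L) (γ)
    (hminA : ∀ K t, |t| ≤ l₀ → ∀ τ ∈ T K \ Bad K t, ∀ v ∈ Adm, IsMinOn (g K t τ v) (SfibA K t τ v) (xA K t τ v))
    (hQ : ∀ K t, |t| ≤ l₀ → ∀ τ ∈ T K \ Bad K t, ∀ v ∈ Adm, Set.MapsTo (Q K t τ v) (Sfib K t τ v) (SfibA K t τ v))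
    (hlift : ∀ K t, |t| ≤ l₀ → ∀ τ ∈ T K \ Bad K t, ∀ v ∈ Adm,
      yA K t τ v ∈ Sfib K t τ v ∧ Q K t τ v (yA K t τ v) = xA K t τ v)
    (hminB : ∀ K t, |t| ≤ l₀ → ∀ τ ∈ T K \ Bad K t, ∀ v ∈ Adm,
      yB K t τ v ∈ Sfib K t τ v ∧ IsMinOn (f₁ K t τ v) (Sfib K t τ v) (yB K t τ v))
    (hact : ∀ K t, |t| ≤ l₀ → ∀ τ ∈ T K \ Bad K t, ∀ v ∈ Adm,
      aA K t τ v = w₀ * g K t τ v (xA K t τ v) + γA K t τ v ∧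
        aB K t τ v = w₀ * f₁ K t τ v (yB K t τ v) + γB K t τ v)
    (hw₀ : 0 ≤ w₀)
    -- (U)(L) PRODUCED for G = U(N) Wilson terms (`interpolation_averaging_UN`): (repr) `hreprU hreprL`, (44) `hA hB`,
    -- (44∇) `hAosc`, smallness `hαK`, decays `hdecay` `hα₁K`, `hcα hε₁`, and `M⁴ ≤ vol`
    (hαK : ∀ K, 0 ≤ αK K ∧ 20480 * (L : ℝ) ^ 2 * αK K ≤ 1)
    (hA : ∀ K t, |t| ≤ l₀ → ∀ τ ∈ T K \ Bad K t, ∀ v ∈ Adm,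
      (∀ x κ, VA K t τ v x κ ∈ unitaryUnits (Matrix n n ℂ)) ∧ IsPeriodic (M * L ^ K * L) (VA K t τ v) ∧
        ∀ (x : B7Prop1Explicit.Site 4) (κ κ' : Fin 4), κ ≠ κ' →
          ‖((hol (VA K t τ v) x (plaqWord κ κ') : (Matrix n n ℂ)ˣ) : Matrix n n ℂ) - 1‖ ≤ αK K)
    (hB : ∀ K t, |t| ≤ l₀ → ∀ τ ∈ T K \ Bad K t, ∀ v ∈ Adm,
      (∀ x κ, VB K t τ v x κ ∈ unitaryUnits (Matrix n n ℂ)) ∧ IsPeriodic (M * L ^ K * L) (VB K t τ v) ∧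
        ∀ (x : B7Prop1Explicit.Site 4) (κ κ' : Fin 4), κ ≠ κ' →
          ‖((hol (VB K t τ v) x (plaqWord κ κ') : (Matrix n n ℂ)ˣ) : Matrix n n ℂ) - 1‖ ≤ αK K)
    (hAosc : ∀ K t, |t| ≤ l₀ → ∀ τ ∈ T K \ Bad K t, ∀ v ∈ Adm, ∀ P ∈ planes,
      ∀ (z : B7Prop1Explicit.Site 4) (κ : Fin 4),
        ‖((VA K t τ v z κ : (Matrix n n ℂ)ˣ) : Matrix n n ℂ) * phiM (VA K t τ v) P (z + e κ)
            * (((VA K t τ v z κ)⁻¹ : (Matrix n n ℂ)ˣ) : Matrix n n ℂ) - phiM (VA K t τ v) P z‖ ≤ α₁K K)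
    (hcα : 0 ≤ cα) (hdecay : ∀ K, αK K ≤ cα * ε₁ * (((L : ℝ) ^ K)⁻¹) ^ 2)
    (hα₁K : ∀ K, 0 ≤ α₁K K ∧ α₁K K ≤ cα₁ * ε₁ * (((L : ℝ) ^ (K + 1))⁻¹) ^ 2 * ((L : ℝ) ^ K)⁻¹)
    (hreprU : ∀ K t, |t| ≤ l₀ → ∀ τ ∈ T K \ Bad K t, ∀ v ∈ Adm,
      f₁ K t τ v (yA K t τ v) = ∑ x ∈ pbox planes (M * L ^ K * L), eN (phiU (VA K t τ v) x) ∧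
        g K t τ v (xA K t τ v) = ∑ y ∈ pbox planes (M * L ^ K), eN (psiU L (VA K t τ v) y))
    (hreprL : ∀ K t, |t| ≤ l₀ → ∀ τ ∈ T K \ Bad K t, ∀ v ∈ Adm,
      f₁ K t τ v (yB K t τ v) = ∑ x ∈ pbox planes (M * L ^ K * L), eN (phiU (VB K t τ v) x) ∧
        g K t τ v (Q K t τ v (yB K t τ v)) = ∑ y ∈ pbox planes (M * L ^ K), eN (psiU L (VB K t τ v) y))
    (hε₁ : 0 ≤ ε₁) (hMvol : ((M : ℝ)) ^ 4 ≤ vol)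
    (hγ : ∀ K t, |t| ≤ l₀ → ∀ τ ∈ T K \ Bad K t, ∀ v ∈ Adm, |γB K t τ v - γA K t τ v| ≤ vol * rγ K)
    (hrγ : Summable rγ)
    -- the residual kind after generation 8: (R-w) radii about a centre `cW`, (W-w) the WITNESS log-ratio centred
    (hwpos : ∀ K t, |t| ≤ l₀ → ∀ τ ∈ T K \ Bad K t, ∀ v ∈ Adm, 0 < wA K t τ v ∧ 0 < wB K t τ v)
    (hRw : ∀ K t, |t| ≤ l₀ → ∀ τ ∈ T K \ Bad K t, ∀ v ∈ Adm,
      |Real.log (wB K t τ v) - Real.log (wA K t τ v) - cW K t τ| ≤ RW K t τ)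
    (hRRw : ∀ K t, |t| ≤ l₀ → ∀ τ ∈ T K \ Bad K t, RW K t τ ≤ vol * rw K) (hrw : Summable rw)
    (hWw : ∀ K t, |t| ≤ l₀ → ∀ τ ∈ T K \ Bad K t, ∀ v ∈ Adm, uA K v = oneA → uB K v = oneB →
      |Real.log (wB K t τ v) - Real.log (wA K t τ v) - c₀ K| ≤ vol * sw K)
    (hsw : Summable sw) :
    GoodClause l₀ vol T A B Bad
        (fun K => (max Cw 1 * ((E + Cr) * ∑ x ∈ antidiagonal K, min (a ^ x.2) (θ' ^ x.1 * Λ ^ x.2))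
            + (EB₀ * Cw * windowSum θ' Λ (jlogOf Cl K) K + (zA K + zB K)
              + (max (2 * Cw) 1 * ((∑ p ∈ antidiagonal K, min (R₁ * gsA K p.1 ^ κ₀) (CrR * θ' ^ p.1 * Λ ^ p.2))
                  + ∑ p ∈ antidiagonal K, min (R₁ * gsB K p.1 ^ κ₀) (CrR * θ' ^ p.1 * Λ ^ p.2))
                + (w₀ * (dUN (Fintype.card n) L planes.card cα cα₁ ε₁ K + dLN (Fintype.card n) L planes.card cα ε₁ K)
                  + rγ K + rw K))))
          + (max Cw 1 * ((E + Cr) * ∑ x ∈ antidiagonal K, min (a ^ x.2) (θ' ^ x.1 * Λ ^ x.2)) + (rw K + sw K))) ∧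
      Summable (fun K => (max Cw 1 * ((E + Cr) * ∑ x ∈ antidiagonal K, min (a ^ x.2) (θ' ^ x.1 * Λ ^ x.2))
            + (EB₀ * Cw * windowSum θ' Λ (jlogOf Cl K) K + (zA K + zB K)
              + (max (2 * Cw) 1 * ((∑ p ∈ antidiagonal K, min (R₁ * gsA K p.1 ^ κ₀) (CrR * θ' ^ p.1 * Λ ^ p.2))
                  + ∑ p ∈ antidiagonal K, min (R₁ * gsB K p.1 ^ κ₀) (CrR * θ' ^ p.1 * Λ ^ p.2))
                + (w₀ * (dUN (Fintype.card n) L planes.card cα cα₁ ε₁ K + dLN (Fintype.card n) L planes.card cα ε₁ K)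
                  + rγ K + rw K))))
          + (max Cw 1 * ((E + Cr) * ∑ x ∈ antidiagonal K, min (a ^ x.2) (θ' ^ x.1 * Λ ^ x.2)) + (rw K + sw K))) := by
  obtain ⟨hU, hLd, hU0, hL0, hUs, hLs⟩ := interpolation_averaging_UN (g := g) (f₁ := f₁) (Q := Q) (yA := yA)
    (yB := yB) (xA := xA) M L hMtwo hLtwo planes hplanes VA VB hαK hA hB hAosc hcα hdecay hα₁K hreprU hreprL hε₁
  have hUdev : ∀ K t, |t| ≤ l₀ → ∀ τ ∈ T K \ Bad K t, ∀ v ∈ Adm,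
      f₁ K t τ v (yA K t τ v) - g K t τ v (xA K t τ v) ≤ vol * dUN (Fintype.card n) L planes.card cα cα₁ ε₁ K :=
    fun K t ht τ hτ v hv => (hU K t ht τ hτ v hv).trans (mul_le_mul_of_nonneg_right hMvol (hU0 K))
  have hLdev : ∀ K t, |t| ≤ l₀ → ∀ τ ∈ T K \ Bad K t, ∀ v ∈ Adm,
      g K t τ v (Q K t τ v (yB K t τ v)) - f₁ K t τ v (yB K t τ v) ≤ vol * dLN (Fintype.card n) L planes.card cα ε₁ K :=
    fun K t ht τ hτ v hv => (hLd K t ht τ hτ v hv).trans (mul_le_mul_of_nonneg_right hMvol (hL0 K))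
  have hdU0 : ∀ K, 0 ≤ dUN (Fintype.card n) L planes.card cα cα₁ ε₁ K := hU0
  have hdL0 : ∀ K, 0 ≤ dLN (Fintype.card n) L planes.card cα ε₁ K := hL0
  have hdU : Summable (dUN (Fintype.card n) L planes.card cα cα₁ ε₁) := hUs
  have hdL : Summable (dLN (Fintype.card n) L planes.card cα ε₁) := hLs
  exact goodClause_summable_of_kindsRA_lift hUR hCr hθ'0 hθ'1 hθ'Λ hΛ1 hCl hURB hEB₀ hURR hCrR hfmtA hfmtB hint hsc
    hoff hS hM hwit hvol hE ha0 ha1 hSle hpend hBwin hMB hnpos hzA hzB hzAs hzBs hq hrsc hMR hRSA hRSB hb h031A h031B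
    hgsA hgsB hR₁ hκ₀ hminA hQ hlift hminB hact hw₀ hUdev hLdev hdU0 hdL0 hdU hdL hγ hrγ hwpos hRw hRRw hrw hWw hsw

end Ledger

/-! ## §6 Toys (non-vacuity of the configuration hypotheses for `U(3)`; the majorants at a trivial point) -/

section Toy

/-- The constant configuration `V ≡ 1` is `U(N)`-valued, periodic of every period, satisfies (44) with `α₀ = 0` and
(44∇) with `α₁ = 0` — so the configuration hypotheses `hA`/`hB`/`hAosc` of `interpolation_averaging_UN` /
`goodClause_summable_UN` are satisfiable at every scale (with `αK ≡ α₁K ≡ 0`, which also satisfy `hαK`, `hdecay`,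
`hα₁K` with `c_α = c_{α1} = 0`).  Here for `U(3)`. [folklore] -/
theorem const_config_hyps_U3 (Np : ℕ) (P : Fin 4 × Fin 4) :
    (∀ (x : B7Prop1Explicit.Site 4) (κ : Fin 4),
        (fun (_ : B7Prop1Explicit.Site 4) (_ : Fin 4) => (1 : (Matrix (Fin 3) (Fin 3) ℂ)ˣ)) x κ
          ∈ unitaryUnits (Matrix (Fin 3) (Fin 3) ℂ)) ∧
      IsPeriodic Np (fun (_ : B7Prop1Explicit.Site 4) (_ : Fin 4) => (1 : (Matrix (Fin 3) (Fin 3) ℂ)ˣ)) ∧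
      (∀ (x : B7Prop1Explicit.Site 4) (κ κ' : Fin 4), κ ≠ κ' →
        ‖((hol (fun (_ : B7Prop1Explicit.Site 4) (_ : Fin 4) => (1 : (Matrix (Fin 3) (Fin 3) ℂ)ˣ)) x (plaqWord κ κ')
            : (Matrix (Fin 3) (Fin 3) ℂ)ˣ) : Matrix (Fin 3) (Fin 3) ℂ) - 1‖ ≤ (0 : ℝ)) ∧
      ∀ (z : B7Prop1Explicit.Site 4) (κ : Fin 4),
        ‖(((fun (_ : B7Prop1Explicit.Site 4) (_ : Fin 4) => (1 : (Matrix (Fin 3) (Fin 3) ℂ)ˣ)) z κ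
              : (Matrix (Fin 3) (Fin 3) ℂ)ˣ) : Matrix (Fin 3) (Fin 3) ℂ)
            * phiM (fun (_ : B7Prop1Explicit.Site 4) (_ : Fin 4) => (1 : (Matrix (Fin 3) (Fin 3) ℂ)ˣ)) P (z + e κ)
            * ((((fun (_ : B7Prop1Explicit.Site 4) (_ : Fin 4) => (1 : (Matrix (Fin 3) (Fin 3) ℂ)ˣ)) z κ)⁻¹
              : (Matrix (Fin 3) (Fin 3) ℂ)ˣ) : Matrix (Fin 3) (Fin 3) ℂ)
          - phiM (fun (_ : B7Prop1Explicit.Site 4) (_ : Fin 4) => (1 : (Matrix (Fin 3) (Fin 3) ℂ)ˣ)) P z‖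
          ≤ (0 : ℝ) := by
  letI : CStarAlgebra (Matrix (Fin 3) (Fin 3) ℂ) := {}
  refine ⟨fun _ _ => Subgroup.one_mem _, fun _ _ => rfl, fun x κ κ' _ => ?_, fun z κ => ?_⟩
  · rw [hol_const_one]; simp
  · simp only [phiM, hol_const_one, Units.val_one, inv_one, one_mul, mul_one, sub_self, norm_zero, le_refl]

/-- … and `αK ≡ 0`, `α₁K ≡ 0`, `c_α = c_{α1} = 0` satisfy `hαK`, `hdecay`, `hα₁K`. [folklore] -/
example (L K : ℕ) (ε₁ : ℝ) :
    ((0 : ℝ) ≤ 0 ∧ 20480 * (L : ℝ) ^ 2 * 0 ≤ 1) ∧ (0 : ℝ) ≤ 0 * ε₁ * (((L : ℝ) ^ K)⁻¹) ^ 2 ∧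
      ((0 : ℝ) ≤ 0 ∧ (0 : ℝ) ≤ 0 * ε₁ * (((L : ℝ) ^ (K + 1))⁻¹) ^ 2 * ((L : ℝ) ^ K)⁻¹) := by
  refine ⟨⟨le_rfl, by norm_num⟩, by simp, le_rfl, by simp⟩

/-- With `ε₁ = 0` both majorants vanish identically: non-vacuity of the shape, nothing more. [folklore] -/
theorem dUN_dLN_zero (N L n : ℕ) (cα cα₁ : ℝ) (K : ℕ) :
    dUN N L n cα cα₁ 0 K = 0 ∧ dLN N L n cα 0 K = 0 := by
  constructor <;> simp [dUN, dLN]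

end Toy

end Literature.MathematicalPhysics.QuantumFieldTheory.Balaban1983to89.T4TermwiseChainUN
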